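import Mathlib
import HarnessLib
import Summits.Langlands.Langlands.Theses.CapacityClassicality

/-!
# Route `CapacityClassicality` — `ArchimedeanSlackNeeded` (item stmt-Langlands-8459), proved

Sharpness of the archimedean hypothesis of `IntegralOverconvergentIsCongruence` (α): the
weight `-4`, level-one example `g = 1/E₄` at `p = 5`.

* `g` has the one-term Katz expansion `g = c₁ · E₄⁻¹`, `c₁ = 1` (the constant form of weight
  `0 = -4 + 1·4` on `Γ₁(1)`), so it is `5`-adically overconvergent in the surrogate sense of α
  (any `r > 0`; we take `r = 1`, `C = 5`);
* the `q`-expansion of `g` has rational-integer coefficients, because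
  `E₄ = 1 + 240 Σ σ₃(n) qⁿ ∈ ℤ⟦q⟧` has constant term `1`
  (Mathlib's `EisensteinSeries.E_qExpansion_coeff`, `B₄ = -1/30`);
* `g · Δ^m` is never the `q`-expansion of a classical modular form of weight `-4 + 12 m` on any
  `Γ₁(M)`: otherwise `F · E₄ = Δ^m` on `ℍ` (multiplicativity and injectivity of `q`-expansions at
  the period `1 ∈ strictPeriods Γ₁(M)`), which is absurd at `ρ = e^{2πi/3}`, where `E₄(ρ) = 0`
  (slash invariance under `S T`, which fixes `ρ`, with factor `(ρ + 1)⁴ ≠ 1`) while `Δ(ρ) ≠ 0`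
  (`ModularForm.discriminant_ne_zero`).

Hence the complex radius of convergence `e^{-π√3} < 1` of `1/E₄` is the only hypothesis of α that
fails: the archimedean term is load-bearing. Everything is Mathlib-level. References: N. Katz,
*p-adic properties of modular schemes and modular forms* (1973) §2.6; R. Coleman, *Classical and
overconvergent modular forms*, Invent. Math. 124 (1996).
-/

set_option linter.dupNamespace false -- `Summit.Langlands.Langlands` is the mandated namespace

noncomputable section

open UpperHalfPlane ModularForm Complex CongruenceSubgroup
open scoped MatrixGroups

namespace Summit.Langlands.Langlands.Theorems.CapacityClassicality

/-! ### `E₄(ρ) = 0` -/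

/-- The level-one Eisenstein series `E₄` vanishes at `ρ = e^{2πi/3}`: `S T` fixes `ρ` and
`E₄((ST)•ρ) = (ρ + 1)⁴ E₄(ρ)` with `(ρ + 1)⁴ = ρ² ≠ 1`. [folklore] -/
theorem E₄_apply_rho : ModularForm.E₄ ρ = 0 := by
  have hST : (ModularGroup.S * ModularGroup.T) • ρ = ρ :=
    ModularGroup.stabilizer_ρ.mpr (by simp)
  -- `E₄ (S • T • ρ) = (denom S (T • ρ))⁴ · E₄ (T • ρ)` (level-one slash invariance)
  have h1 := by
    have hinst : SlashInvariantFormClass (ModularForm 𝒮ℒ 4) Γ(1) 4 := by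
      rw [Gamma_one_coe_eq_SL]; infer_instance
    exact SlashInvariantForm.slash_action_eqn_SL'' (Γ := Γ(1)) ModularForm.E₄
      (mem_Gamma_one ModularGroup.S) (ModularGroup.T • ρ)
  rw [← mul_smul, hST, ModularGroup.denom_S, modular_T_smul,
    SlashInvariantForm.vAdd_apply_of_mem_strictPeriods E₄ ρ one_mem_strictPeriods_SL,
    coe_vadd] at h1
  have hρ4 : ((1 : ℝ) + (ρ : ℂ)) ^ (4 : ℤ) = -ρ - 1 := by
    have h2 : ((1 : ℂ) + ρ) ^ 2 = ρ := by linear_combination ρ_sq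
    rw [ofReal_one, show (4 : ℤ) = ((2 * 2 : ℕ) : ℤ) by norm_num, zpow_natCast, pow_mul, h2, ρ_sq]
  rw [hρ4] at h1
  have h2 : ((ρ : ℂ) + 2) * E₄ ρ = 0 := by linear_combination h1
  rcases mul_eq_zero.mp h2 with h | h
  · exfalso
    have him := congr_arg Complex.im h
    simp only [add_im, UpperHalfPlane.coe_im, zero_im] at him
    have := ρ.im_pos
    norm_num at him
    linarith
  · exact h

/-! ### Integrality of `1/E₄` -/

/-- `E₄ = 1 + 240 Σ_{n ≥ 1} σ₃(n) qⁿ` is the image of an integer power series with constant term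
`1`. [folklore] -/
theorem qExpansion_E₄_eq_map :
    qExpansion 1 ⇑ModularForm.E₄ =
      PowerSeries.map (Int.castRingHom ℂ)
        (PowerSeries.mk fun m ↦
          if m = 0 then (1 : ℤ) else 240 * (ArithmeticFunction.sigma 3 m : ℤ)) := by
  ext m
  rw [PowerSeries.coeff_map, PowerSeries.coeff_mk, ModularForm.E₄,
    EisensteinSeries.E_qExpansion_coeff (by norm_num) (by decide) m,
    show bernoulli 4 = -1 / 30 by
      rw [bernoulli_eq_bernoulli'_of_ne_one (by norm_num), bernoulli'_four]]
  split_ifs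
  · simp
  · push_cast
    norm_num

/-- The `q`-expansion of `1/E₄` has rational-integer, hence algebraic-integer, coefficients.
[folklore] -/
theorem isIntegral_coeff_inv_qExpansion_E₄ (n : ℕ) :
    IsIntegral ℤ (PowerSeries.coeff n (qExpansion 1 ⇑ModularForm.E₄)⁻¹) := by
  set P : PowerSeries ℤ :=
    PowerSeries.mk fun m ↦ if m = 0 then (1 : ℤ) else 240 * (ArithmeticFunction.sigma 3 m : ℤ)
    with hP
  have hP1 : PowerSeries.constantCoeff P = ((1 : ℤˣ) : ℤ) := by
    rw [← PowerSeries.coeff_zero_eq_constantCoeff_apply, hP, PowerSeries.coeff_mk]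
    simp
  have hmap : qExpansion 1 ⇑ModularForm.E₄ = PowerSeries.map (Int.castRingHom ℂ) P :=
    qExpansion_E₄_eq_map
  have h0 : PowerSeries.constantCoeff (qExpansion 1 ⇑ModularForm.E₄) ≠ 0 := by
    rw [hmap, ← PowerSeries.coeff_zero_eq_constantCoeff_apply, PowerSeries.coeff_map,
      PowerSeries.coeff_zero_eq_constantCoeff_apply, hP1]
    simp
  have hinv : (qExpansion 1 ⇑ModularForm.E₄)⁻¹ =
      PowerSeries.map (Int.castRingHom ℂ) (P.invOfUnit 1) := by
    rw [PowerSeries.inv_eq_iff_mul_eq_one h0, hmap, ← map_mul, PowerSeries.invOfUnit_mul P 1 hP1,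
      map_one]
  rw [hinv, PowerSeries.coeff_map]
  exact isIntegral_algebraMap

/-! ### `E₄⁻¹ Δ^m` is not classical -/

/-- No classical modular form of weight `-4 + 12 m` on any `Γ₁(M)` has `q`-expansion
`E₄⁻¹ · Δ^m`: such an `F` would satisfy `F · E₄ = Δ^m` on `ℍ`, impossible at `ρ`. [folklore] -/
theorem not_exists_modularForm_qExpansion_eq_inv_E₄_mul :
    ¬ ∃ (M : ℕ) (_ : NeZero M) (m : ℕ)
        (F : ModularForm (CongruenceSubgroup.Gamma1 M) ((-4 : ℤ) + 12 * m)),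
        qExpansion 1 ⇑F =
          (qExpansion 1 ⇑ModularForm.E₄)⁻¹ * (qExpansion 1 ⇑CuspForm.discriminant) ^ m := by
  rintro ⟨M, hM, m, F, hF⟩
  have hΓ : (1 : ℝ) ∈ (Gamma1 M : Subgroup (GL (Fin 2) ℝ)).strictPeriods := by simp
  have hFan := ModularFormClass.analyticAt_cuspFunction_zero F one_pos hΓ
  have hEan := ModularFormClass.analyticAt_cuspFunction_zero ModularForm.E₄ one_pos
    one_mem_strictPeriods_SL
  have h0 : PowerSeries.constantCoeff (qExpansion 1 ⇑ModularForm.E₄) ≠ 0 := by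
    rw [← PowerSeries.coeff_zero_eq_constantCoeff_apply, ModularForm.E₄,
      EisensteinSeries.E_qExpansion_coeff_zero (by norm_num) (by decide)]
    exact one_ne_zero
  -- `Δ^m` as a level-one modular form
  set D : ModularForm 𝒮ℒ 12 := (CuspForm.discriminant : ModularForm 𝒮ℒ 12) with hD
  have hDcoe : (⇑D : ℍ → ℂ) = ⇑CuspForm.discriminant := rfl
  have hDan := ModularFormClass.analyticAt_cuspFunction_zero (D.pow m) one_pos
    one_mem_strictPeriods_SL
  -- q-expansion of `F · E₄ - Δ^m` vanishes
  have hprod : qExpansion 1 (⇑F * ⇑ModularForm.E₄) =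
      (qExpansion 1 ⇑CuspForm.discriminant) ^ m := by
    rw [qExpansion_mul hFan hEan, hF, mul_assoc, mul_comm _ (qExpansion 1 ⇑ModularForm.E₄),
      ← mul_assoc, PowerSeries.inv_mul_cancel _ h0, one_mul]
  have hpow : qExpansion 1 ⇑(D.pow m) = (qExpansion 1 ⇑CuspForm.discriminant) ^ m := by
    rw [ModularForm.qExpansion_pow one_pos one_mem_strictPeriods_SL, hDcoe]
  have hGan : AnalyticAt ℂ (cuspFunction 1 (⇑F * ⇑ModularForm.E₄)) 0 := by
    rw [cuspFunction_mul hFan.continuousAt hEan.continuousAt]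
    exact hFan.mul hEan
  have hq0 : qExpansion 1 (⇑F * ⇑ModularForm.E₄ - ⇑(D.pow m)) = 0 := by
    rw [qExpansion_sub hGan hDan, hprod, hpow, sub_self]
  -- hence the function vanishes identically
  have hper : Function.Periodic ((⇑F * ⇑ModularForm.E₄ - ⇑(D.pow m)) ∘ ofComplex) 1 :=
    ((SlashInvariantFormClass.periodic_comp_ofComplex F hΓ).mul
      (SlashInvariantFormClass.periodic_comp_ofComplex ModularForm.E₄ one_mem_strictPeriods_SL)).sub
      (SlashInvariantFormClass.periodic_comp_ofComplex (D.pow m) one_mem_strictPeriods_SL)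
  have hhol := ((ModularFormClass.holo F).mul (ModularFormClass.holo ModularForm.E₄)).sub
    (ModularFormClass.holo (D.pow m))
  have hbdd : IsBoundedAtImInfty (⇑F * ⇑ModularForm.E₄ - ⇑(D.pow m)) :=
    ((ModularFormClass.bdd_at_infty F).mul (ModularFormClass.bdd_at_infty ModularForm.E₄)).sub
      (ModularFormClass.bdd_at_infty (D.pow m))
  have hfun := (qExpansion_eq_zero_iff one_pos hper hhol hbdd).mp hq0
  -- evaluate at `ρ`
  have hρ := congr_fun hfun ρ
  simp only [Pi.sub_apply, Pi.mul_apply, Pi.zero_apply, E₄_apply_rho, mul_zero, zero_sub,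
    neg_eq_zero, ModularForm.coe_pow, Pi.pow_apply, hDcoe, CuspForm.coe_discriminant] at hρ
  exact pow_ne_zero m (ModularForm.discriminant_ne_zero ρ) hρ

/-! ### The item -/

/-- **`ArchimedeanSlackNeeded`** (item stmt-Langlands-8459 of route `CapacityClassicality`):
for `p = 5`, `g = 1/E₄` has a one-term Katz expansion (`c₁ = 1` of weight `0 = -4 + 4`, all other
`c_i = 0`; `r = 1`, `C = 5`), rational-integer `q`-expansion coefficients, and `g · Δ^m` is never
the `q`-expansion of a classical modular form of weight `-4 + 12 m` on any `Γ₁(M)`. [folklore] -/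
theorem archimedeanSlackNeeded_proof :
    Summit.Langlands.Langlands.Theses.CapacityClassicality.ArchimedeanSlackNeeded := by
  intro _ ι
  refine ⟨?_, isIntegral_coeff_inv_qExpansion_E₄, not_exists_modularForm_qExpansion_eq_inv_E₄_mul⟩
  -- the Katz expansion: `c 1 = 1`, `c i = 0` otherwise
  refine ⟨1, 5, Pi.single 1 1, one_pos, ?_, ?_, ?_⟩
  · intro i
    by_cases hi : i = 1
    · subst hi
      have h01 : (0 : ℤ) = (-4 : ℤ) + (1 : ℕ) * (5 - 1 : ℕ) := by norm_num
      refine ⟨ModularForm.mcast h01 1, ?_⟩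
      rw [Pi.single_eq_same, ModularForm.qExpansion_mcast, ModularForm.qExpansion_one]
    · exact ⟨0, by rw [Pi.single_eq_of_ne hi, ModularForm.coe_zero, qExpansion_zero]⟩
  · intro i n
    by_cases hi : i = 1
    · subst hi
      rw [Pi.single_eq_same, PowerSeries.coeff_one, Nat.cast_one, mul_one, Real.rpow_neg_one]
      split_ifs <;> norm_num
    · rw [Pi.single_eq_of_ne hi, map_zero, map_zero, norm_zero]
      positivity
  · intro n
    have key : ∀ i : ℕ, i ≠ 1 →
        ι.symm (PowerSeries.coeff n ((Pi.single 1 1 : ℕ → PowerSeries ℂ) i *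
          ((qExpansion 1 ⇑(ModularForm.E (show 3 ≤ 5 - 1 by omega)))⁻¹) ^ i)) = 0 := by
      intro i hi
      rw [Pi.single_eq_of_ne hi, zero_mul, map_zero, map_zero]
    convert hasSum_single 1 key using 1
    rw [Pi.single_eq_same, one_mul, pow_one]

end Summit.Langlands.Langlands.Theorems.CapacityClassicality

end
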